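import Mathlib
import Summits.Ventures.HodgeRepro2.T5SU11Unimodular
import Summits.Ventures.HodgeRepro2.Tier7.Line3.UnitaryOneOneCentre

/-!
# Tier7/Line3/U11Bridge — `UnitaryOneOneCentre.IsU11 / IsSU11` ARE p1's `T5UnitaryBound.MemU11` / the subgroup
`T5SU11Unimodular.SU11` (seat t7-x1, gen 2; crit-2's record (2) on p678239, STATUS l. 15312)

`UnitaryOneOneCentre` (p678239) carries its own matrix predicates `IsU11 g := gᴴ J g = J` (`J = diagonal ![1, −1]`) and
`IsSU11 g := IsU11 g ∧ det g = 1`; p1's model rows and L1-p5's `KappaDecay` live on the subgroup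
`T5SU11Unimodular.SU11 ⊂ SL₂(ℂ)` (the range of the Cayley homomorphism), characterised by p1's
`mem_SU11_iff : g ∈ SU11 ↔ MemU11 g` with `MemU11 g := gᴴ J g = J`, `J = !![1, 0; 0, −1]`. The two `J`s are the
same matrix (`J_eq`), so the predicates agree (`isU11_iff_memU11`), an `IsSU11` matrix IS an element of `SU11`
(`toSU11`, `coe_toSU11`, `isSU11_iff_mem_SU11`), and the `U(1,1) = U(1) · SU(1,1)` decomposition reads in p1's type:
**`exists_smul_SU11`: every `g` with `IsU11 g` is `z • s` with `‖z‖ = 1` and `s : SU11`** — the one-liner crit-2 asked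
for (the passage «IsSU11 s ⇒ s ∈ SU11» is `mem_SU11_iff`, i.e. p1's surjectivity of the Cayley transform onto the
matrix group, consumed by name). Nothing about (N) or HC_CM; §8(d): NO.
Blind lane: Mathlib + the HodgeRepro2 prefix only; no sorry; axioms ⊆ {propext, Classical.choice, Quot.sound}.
-/

namespace Summit.Ventures.HodgeRepro2.Tier7.Line3.U11Bridge

open Matrix
open Summit.Ventures.HodgeRepro2.Tier7.Line3.UnitaryOneOneCentre
open Summit.Ventures.HodgeRepro2.T5SU11Unimodular

/-- the two hermitian forms are the same matrix: `diagonal ![1, −1] = !![1, 0; 0, −1]`. -/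
theorem J_eq : UnitaryOneOneCentre.J = T5UnitaryBound.J := by
  unfold UnitaryOneOneCentre.J T5UnitaryBound.J
  ext i j
  fin_cases i <;> fin_cases j <;> simp

/-- `IsU11 g ↔ MemU11 g` (p1's predicate). -/
theorem isU11_iff_memU11 (g : Matrix (Fin 2) (Fin 2) ℂ) : IsU11 g ↔ T5UnitaryBound.MemU11 g := by
  unfold IsU11 T5UnitaryBound.MemU11
  rw [J_eq]

/-- an `IsSU11` matrix as an element of p1's subgroup `SU11 ⊂ SL₂(ℂ)`. -/
noncomputable def toSU11 (s : Matrix (Fin 2) (Fin 2) ℂ) (hs : IsSU11 s) : SU11 :=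
  ⟨⟨s, hs.2⟩, (mem_SU11_iff _).2 ((isU11_iff_memU11 s).1 hs.1)⟩

/-- the matrix of `toSU11 s hs` is `s`. -/
theorem coe_toSU11 (s : Matrix (Fin 2) (Fin 2) ℂ) (hs : IsSU11 s) :
    ((toSU11 s hs : SpecialLinearGroup (Fin 2) ℂ) : Matrix (Fin 2) (Fin 2) ℂ) = s := rfl

/-- `IsSU11` of the matrix of `g ∈ SL₂(ℂ)` is membership in `SU11`. -/
theorem isSU11_iff_mem_SU11 (g : SpecialLinearGroup (Fin 2) ℂ) :
    IsSU11 (g : Matrix (Fin 2) (Fin 2) ℂ) ↔ g ∈ SU11 := by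
  rw [mem_SU11_iff, ← isU11_iff_memU11]
  exact ⟨fun h => h.1, fun h => ⟨h, Matrix.SpecialLinearGroup.det_coe g⟩⟩

/-- the matrix of an element of `SU11` is `IsSU11`. -/
theorem isSU11_coe (s : SU11) : IsSU11 ((s : SpecialLinearGroup (Fin 2) ℂ) : Matrix (Fin 2) (Fin 2) ℂ) :=
  (isSU11_iff_mem_SU11 _).2 s.2

/-- **`U(1,1) = U(1) · SU11` in p1's type**: every `g` with `IsU11 g` is `z • s` with `‖z‖ = 1`, `z ^ 2 = det g` and
`s : SU11`. -/
theorem exists_smul_SU11 {g : Matrix (Fin 2) (Fin 2) ℂ} (hg : IsU11 g) :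
    ∃ z : ℂ, ∃ s : SU11, ‖z‖ = 1 ∧ z ^ 2 = g.det ∧
      g = z • ((s : SpecialLinearGroup (Fin 2) ℂ) : Matrix (Fin 2) (Fin 2) ℂ) := by
  obtain ⟨z, s, hz, hz2, hs, hg'⟩ := exists_smul_su11 hg
  exact ⟨z, toSU11 s hs, hz, hz2, by rw [coe_toSU11]; exact hg'⟩

/-- the antidiagonal torus element `diagonal ![u, u⁻¹]` (`‖u‖ = 1`) as an element of `SU11`. -/
noncomputable def antiDiagSU11 (u : ℂ) (hu : ‖u‖ = 1) : SU11 :=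
  toSU11 (diagonal ![u, u⁻¹]) (isSU11_diagonal_inv hu)

/-- its matrix. -/
theorem coe_antiDiagSU11 (u : ℂ) (hu : ‖u‖ = 1) :
    ((antiDiagSU11 u hu : SpecialLinearGroup (Fin 2) ℂ) : Matrix (Fin 2) (Fin 2) ℂ) = diagonal ![u, u⁻¹] := rfl

end Summit.Ventures.HodgeRepro2.Tier7.Line3.U11Bridge
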